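import Summits.Ventures.CertifiedManyBodySolver.Observables.NeelClassKineticFloor
import Summits.Ventures.CertifiedManyBodySolver.Certificates.HubbardSquare_n4o5_upper_derived_row526
import Summits.Ventures.CertifiedManyBodySolver.Certificates.HubbardSquare_n1_upper_pb2_U8_row472
import HarnessLib

/-!
# Ventures/CertifiedManyBodySolver — Observables/NeelClassExclusionDensities.lean

HONEST FRAMING: first certified bounds; not a superconductivity verdict; every number certified or labelled float.
A competing-order EXCLUSION removes a named class of candidate ground states; it never says which order is present;
no phase sentence follows.

Cell `hubbard-tc` (MO-S3, D-0096), seat `hubbard-tc-mod-3` (G3: competing orders — stripe/CDW/AF — as EXCLUSION inputs from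
certified energy ORDERINGS), `prover-hubbard-tc-mod-3-g7-0`. Part 2 (other densities: `n = 4/5, 3/4, 1`) of `NeelClassExclusionA0.lean`. **The AF item of the seat's row: «Néel (antiferromagnetic)
MEAN-FIELD CLASS excluded» words, as ENERGY ORDERINGS.** The class (any even torus `(ℤ/Lℤ)²`, any particle-number mixture):
Fock vectors of mean density `n`, staggered magnetisation `m` (`Re⟨Ô⟩ = 2mL²‖φ‖²`, `Ô = Σ_x (−1)^{x₁+x₂}(n_{x↑} − n_{x↓})`) and
AT LEAST THE HARTREE DOUBLE OCCUPANCY OF THEIR OWN NÉEL ORDER, `Re⟨D̂⟩ ≥ (n²/4 − m²)L²‖φ‖²` — it contains every collinear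
two-sublattice (Néel / spin-density-wave) Hartree–Fock Slater state with uniform sublattice moments (Wick: equality), every
non-magnetic quasi-free and singlet-paired BCS state (`m = 0`, the MF/BCS class of the seat's earlier words) and every correlated
state whose double-occupancy deficit below `(n/2)²` is no larger than `m²`; it does NOT contain stripes / spirals with modulated
moment size. The KERNEL floor (hypothesis-free, `NeelClassKineticFloor.lean`): energy per site
`≥ 2δ|m| + δ(1 − n) − √(4 + δ²) + U(n²/4 − m²)` for every admissible `δ` (`t′ ≤ 0`). The WORDS compare it with CERTIFIED
ground-state energy CEILINGS of the sr-mbsolver GRID (claim nodes, BY HYPOTHESIS — each word is exactly as strong as its cap):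

* the `n = 7/8` words (A0 / A0′ anchors, `U`- and `t′`-windows): `NeelClassExclusionA0.lean`;
* `neelClass_energy_ge_n45` — `(8, 4/5, 0)`, caps #450 ∧ #524 (derived chord #526): gap `≥ 11/100`;
* `neelClass_energy_ge_n34` — `(8, 3/4, 0)`, cap #450: gap `≥ 1/25`;
* `neelClass_energy_ge_halfFilling` — `(8, 1, 0)`, cap #472: gap `≥ 1/256` (floor exactly `−1/2` at `|m| = √3/4`).

Reading: "no state of the Néel mean-field class on any even torus comes within the stated gap (per site, units of `t`) of the
thermodynamic ground-state energy density `e₀(1, t′, U, n)`" — in particular the antiferromagnetic Hartree–Fock description is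
certified-excluded as the ground state at these cuprate-regime points, quantitatively. Float context (designer
`hubbard-tc-mod-3` g7 `work/neel/`): exact self-consistent Néel-HF energies `E_AFHF(8,7/8,0) ≈ −0.527`, `(8,7/8,−1/4) ≈ −0.512`,
`(8,4/5,0) ≈ −0.571`, `(8,3/4,0) ≈ −0.605`, `(8,1,0) ≈ −0.466` [float]; the kernel floor is the Jensen/Cauchy–Schwarz relaxation of
the SDW band sum and loses `≈ 0.05·t` at the binding moment. Each word: piecewise-constant `δ` over `|m|`-pieces (`2|m| ≤ n`,
`two_abs_stag_le_density`), `√(4+δ²)` bounded by a rational, then `nlinarith` on the concave quadratic in `|m|`.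
WHAT THIS IS NOT: a statement that antiferromagnetic ORDER is absent (correlated Néel-ordered states with a larger docc deficit are
outside the class); a statement about stripes, d-wave order or T_c; a phase word.

References: V. Bach, E. H. Lieb, J. P. Solovej, J. Stat. Phys. 76 (1994) 3, §2 eq. (2c.36) [BachLiebSolovej1994]; E. H. Lieb,
M. Loss, Duke Math. J. 71 (1993) 337, §8 Thm 8.2 [LiebLoss1993]; J. S. Langer, D. C. Mattis, Phys. Lett. 36A (1971) 139 [LangerMattis1971];
R. B. Israel, Convexity in the Theory of Lattice Gases (1979), Thm I.3.4 [Israel1979]; T. Koma, H. Tasaki, J. Stat. Phys. 76 (1994) 745,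
§1 [KomaTasaki1994]; D. Ruelle, Statistical Mechanics (1969) §3.3 [Ruelle1969]; H. Xu et al., Science 384 (2024) eadh7691 [XuEtAl2024].
-/

noncomputable section

namespace Summit.Ventures.CertifiedManyBodySolver.Observables

open Literature.MathematicalPhysics.QuantumLattice
open Literature.MathematicalPhysics.QuantumLattice.ThermodynamicLimit
open Summit.Ventures.CertifiedManyBodySolver.Certificates
open Matrix Finset Literature.Probability.LatticeModels
  Literature.MathematicalPhysics.QuantumLattice.RayleighBound
  Literature.MathematicalPhysics.QuantumLattice.LangerMattis
  Literature.MathematicalPhysics.QuantumLattice.HartreeFock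
  NeelClassFloor
open scoped ComplexOrder

variable {L : ℕ} [NeZero L]

/-- **`(8, 4/5, 0)` — Néel mean-field class excluded with a `0.11·t` gap** (conditional BY HYPOTHESIS on the CERTIFIED caps #450 ∧ #524
through the DERIVED density-chord row #526: `e₀(1,0,8,4/5) ≤ −0.8052991400`, `derived_sq_U8_n4o5_tp0_chord_r450_r524_TT'`): every
state of the Néel mean-field class at density `4/5` (`Re⟨D̂⟩ ≥ (4/25 − m²)L²‖φ‖²`) on every even torus has energy per site
`≥ e₀(1, 0, 8, 4/5) + 11/100` (binding `m = 0`: floor `−0.6796`, margin `+0.126`, slack ≥ 0.016).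
[cite: BachLiebSolovej1994, §2 eq. (2c.36)] [cite: Ruelle1969, §3.3] -/
theorem neelClass_energy_ge_n45 (h450 : cert_r450_openbox_32x4_U8_N96_tp0_D1400_b2) (hRS : cert_dbt299plaqRS_allk) (hL : 3 ≤ L) (hLe : Even L) {m : ℝ}
    {φ : Fock (Orb (FermionTorus 2 L))} (hφ : φ ≠ 0)
    (hN : (star φ ⬝ᵥ (totalNumber *ᵥ φ)).re = 4 / 5 * (L : ℝ) ^ 2 * normSq φ)
    (hO : (star φ ⬝ᵥ ((dGammaSpin 0 (stagMatrix 2 L) - dGammaSpin 1 (stagMatrix 2 L)) *ᵥ φ)).re =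
      2 * m * (L : ℝ) ^ 2 * normSq φ)
    (hD : ((4 / 5 : ℝ) ^ 2 / 4 - m ^ 2) * (L : ℝ) ^ 2 * normSq φ ≤
      (star φ ⬝ᵥ ((∑ x : FermionTorus 2 L, numberOp x 0 * numberOp x 1) *ᵥ φ)).re) :
    energyDensityTT' 1 0 8 (4 / 5) + 11 / 100 ≤
      (star φ ⬝ᵥ (hubbardTorusTT' L 1 0 8 *ᵥ φ)).re / ((L : ℝ) ^ 2 * normSq φ) := by
  have hcap : energyDensityTT' 1 0 8 (4 / 5) ≤ -0.8052991400 := by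
    refine (DerivedR450R524N.derived_sq_U8_n4o5_tp0_chord_r450_r524_TT' h450 hRS).trans ?_
    push_cast
    norm_num
  have hm : 2 * |m| ≤ 4 / 5 := two_abs_stag_le_density hφ hN hO
  have h0 : 0 ≤ |m| := abs_nonneg m
  have hsq : m ^ 2 = |m| ^ 2 := (sq_abs m).symm
  have key : ∀ δ : ℝ, 0 < δ → 
      2 * δ * |m| + δ * (1 - 4 / 5) - Real.sqrt (4 * (1 : ℝ) ^ 2 + δ ^ 2) + 8 * ((4 / 5 : ℝ) ^ 2 / 4 - |m| ^ 2) ≤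
        (star φ ⬝ᵥ (hubbardTorusTT' L 1 0 8 *ᵥ φ)).re / ((L : ℝ) ^ 2 * normSq φ) := by
    intro δ hδ
    have h := neelClass_energy_per_site_ge hL hLe 1 (t' := 0) (U := 8) le_rfl (by norm_num) hδ
      (by rw [abs_zero]; linarith) (by rw [abs_zero]; norm_num) hφ hN hO hD
    rw [hsq] at h
    exact h
  rcases le_or_gt |m| (1 / 10) with c1 | c1
  · -- piece 1: |m| ∈ [0, 1/10], δ = 41/100, √(4+δ²) ≤ 2041593/1000000 (slack 0.0157)
    have h := key (41 / 100) (by norm_num)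
    have hr : Real.sqrt (4 * (1 : ℝ) ^ 2 + (41 / 100 : ℝ) ^ 2) ≤ 2041593 / 1000000 :=
      (Real.sqrt_le_sqrt (by norm_num)).trans_eq (Real.sqrt_sq (by norm_num))
    linarith [mul_nonneg h0 (sub_nonneg.2 c1), h, hr, hcap]
  rcases le_or_gt |m| (1 / 5) with c2 | c2
  · -- piece 2: |m| ∈ [1/10, 1/5], δ = 6/5, √(4+δ²) ≤ 2332381/1000000 (slack 0.0429)
    have h := key (6 / 5) (by norm_num)
    have hr : Real.sqrt (4 * (1 : ℝ) ^ 2 + (6 / 5 : ℝ) ^ 2) ≤ 2332381 / 1000000 :=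
      (Real.sqrt_le_sqrt (by norm_num)).trans_eq (Real.sqrt_sq (by norm_num))
    linarith [mul_nonneg (sub_nonneg.2 c1.le) (sub_nonneg.2 c2), h, hr, hcap]
  rcases le_or_gt |m| (3 / 10) with c3 | c3
  · -- piece 3: |m| ∈ [1/5, 3/10], δ = 2, √(4+δ²) ≤ 707107/250000 (slack 0.0269)
    have h := key (2) (by norm_num)
    have hr : Real.sqrt (4 * (1 : ℝ) ^ 2 + (2 : ℝ) ^ 2) ≤ 707107 / 250000 :=
      (Real.sqrt_le_sqrt (by norm_num)).trans_eq (Real.sqrt_sq (by norm_num))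
    linarith [mul_nonneg (sub_nonneg.2 c2.le) (sub_nonneg.2 c3), h, hr, hcap]
  -- piece 4: |m| ∈ [3/10, 2/5], δ = 14/5, √(4+δ²) ≤ 3440931/1000000 (slack 0.0544)
  have h := key (14 / 5) (by norm_num)
  have hr : Real.sqrt (4 * (1 : ℝ) ^ 2 + (14 / 5 : ℝ) ^ 2) ≤ 3440931 / 1000000 :=
    (Real.sqrt_le_sqrt (by norm_num)).trans_eq (Real.sqrt_sq (by norm_num))
  linarith [mul_nonneg (sub_nonneg.2 c3.le) (sub_nonneg.2 (show |m| ≤ 2 / 5 by linarith)), h, hr, hcap]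

/-- **`(8, 3/4, 0)` — Néel mean-field class excluded with a `0.04·t` gap** (conditional on the CERTIFIED cap #450 BY HYPOTHESIS, claim
node `cert_r450_openbox_32x4_U8_N96_tp0_D1400_b2`: `e₀(1,0,8,3/4) ≤ −0.8675041165`): every state of the Néel mean-field class at
density `3/4` (`Re⟨D̂⟩ ≥ (9/64 − m²)L²‖φ‖²`) on every even torus has energy per site `≥ e₀(1, 0, 8, 3/4) + 1/25` (binding `m = 0`:
floor `−0.8115`, margin `+0.056`, slack ≥ 0.016). [cite: BachLiebSolovej1994, §2 eq. (2c.36)] [cite: Ruelle1969, §3.3] -/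
theorem neelClass_energy_ge_n34 (h450 : cert_r450_openbox_32x4_U8_N96_tp0_D1400_b2) (hL : 3 ≤ L) (hLe : Even L) {m : ℝ}
    {φ : Fock (Orb (FermionTorus 2 L))} (hφ : φ ≠ 0)
    (hN : (star φ ⬝ᵥ (totalNumber *ᵥ φ)).re = 3 / 4 * (L : ℝ) ^ 2 * normSq φ)
    (hO : (star φ ⬝ᵥ ((dGammaSpin 0 (stagMatrix 2 L) - dGammaSpin 1 (stagMatrix 2 L)) *ᵥ φ)).re =
      2 * m * (L : ℝ) ^ 2 * normSq φ)
    (hD : ((3 / 4 : ℝ) ^ 2 / 4 - m ^ 2) * (L : ℝ) ^ 2 * normSq φ ≤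
      (star φ ⬝ᵥ ((∑ x : FermionTorus 2 L, numberOp x 0 * numberOp x 1) *ᵥ φ)).re) :
    energyDensityTT' 1 0 8 (3 / 4) + 1 / 25 ≤
      (star φ ⬝ᵥ (hubbardTorusTT' L 1 0 8 *ᵥ φ)).re / ((L : ℝ) ^ 2 * normSq φ) := by
  have hcap : energyDensityTT' 1 0 8 (3 / 4) ≤ -0.8675041165 := by
    refine (m3grid_U8_n3o4_tp0_upper_r450_print h450).trans ?_
    push_cast
    norm_num
  have hm : 2 * |m| ≤ 3 / 4 := two_abs_stag_le_density hφ hN hO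
  have h0 : 0 ≤ |m| := abs_nonneg m
  have hsq : m ^ 2 = |m| ^ 2 := (sq_abs m).symm
  have key : ∀ δ : ℝ, 0 < δ → 
      2 * δ * |m| + δ * (1 - 3 / 4) - Real.sqrt (4 * (1 : ℝ) ^ 2 + δ ^ 2) + 8 * ((3 / 4 : ℝ) ^ 2 / 4 - |m| ^ 2) ≤
        (star φ ⬝ᵥ (hubbardTorusTT' L 1 0 8 *ᵥ φ)).re / ((L : ℝ) ^ 2 * normSq φ) := by
    intro δ hδ
    have h := neelClass_energy_per_site_ge hL hLe 1 (t' := 0) (U := 8) le_rfl (by norm_num) hδ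
      (by rw [abs_zero]; linarith) (by rw [abs_zero]; norm_num) hφ hN hO hD
    rw [hsq] at h
    exact h
  rcases le_or_gt |m| (3 / 32) with c1 | c1
  · -- piece 1: |m| ∈ [0, 3/32], δ = 13/25, √(4+δ²) ≤ 413299/200000 (slack 0.0160)
    have h := key (13 / 25) (by norm_num)
    have hr : Real.sqrt (4 * (1 : ℝ) ^ 2 + (13 / 25 : ℝ) ^ 2) ≤ 413299 / 200000 :=
      (Real.sqrt_le_sqrt (by norm_num)).trans_eq (Real.sqrt_sq (by norm_num))
    linarith [mul_nonneg h0 (sub_nonneg.2 c1), h, hr, hcap]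
  rcases le_or_gt |m| (3 / 16) with c2 | c2
  · -- piece 2: |m| ∈ [3/32, 3/16], δ = 113/100, √(4+δ²) ≤ 2297151/1000000 (slack 0.0794)
    have h := key (113 / 100) (by norm_num)
    have hr : Real.sqrt (4 * (1 : ℝ) ^ 2 + (113 / 100 : ℝ) ^ 2) ≤ 2297151 / 1000000 :=
      (Real.sqrt_le_sqrt (by norm_num)).trans_eq (Real.sqrt_sq (by norm_num))
    linarith [mul_nonneg (sub_nonneg.2 c1.le) (sub_nonneg.2 c2), h, hr, hcap]
  rcases le_or_gt |m| (9 / 32) with c3 | c3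
  · -- piece 3: |m| ∈ [3/16, 9/32], δ = 47/25, √(4+δ²) ≤ 2744887/1000000 (slack 0.1014)
    have h := key (47 / 25) (by norm_num)
    have hr : Real.sqrt (4 * (1 : ℝ) ^ 2 + (47 / 25 : ℝ) ^ 2) ≤ 2744887 / 1000000 :=
      (Real.sqrt_le_sqrt (by norm_num)).trans_eq (Real.sqrt_sq (by norm_num))
    linarith [mul_nonneg (sub_nonneg.2 c2.le) (sub_nonneg.2 c3), h, hr, hcap]
  -- piece 4: |m| ∈ [9/32, 3/8], δ = 279/100, √(4+δ²) ≤ 1716399/500000 (slack 0.1538)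
  have h := key (279 / 100) (by norm_num)
  have hr : Real.sqrt (4 * (1 : ℝ) ^ 2 + (279 / 100 : ℝ) ^ 2) ≤ 1716399 / 500000 :=
    (Real.sqrt_le_sqrt (by norm_num)).trans_eq (Real.sqrt_sq (by norm_num))
  linarith [mul_nonneg (sub_nonneg.2 c3.le) (sub_nonneg.2 (show |m| ≤ 3 / 8 by linarith)), h, hr, hcap]

/-- **Half filling `(8, 1, 0)` — even there, the Néel MEAN-FIELD class misses the ground-state energy density by `≥ t/256`**
(conditional on the CERTIFIED cap #472 BY HYPOTHESIS, claim node `cert_r472_pb2_tl_upper_n1_U8`: `e₀(1,0,8,1) ≤ −0.5087724429`).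
Every state of the Néel mean-field class at density `1` (`Re⟨D̂⟩ ≥ (1/4 − m²)L²‖φ‖²`; e.g. the self-consistent antiferromagnetic
Hartree–Fock state) on every even torus has energy per site `≥ e₀(1, 0, 8, 1) + 1/256` (binding `|m| = √3/4`: floor `−1/2` exactly,
margin `+0.0088`, slack ≥ 0.0036). The exact AF-HF energy is `≈ −0.4659` [float]; the certified statement is the `t/256` gap.
[cite: BachLiebSolovej1994, §2 eq. (2c.36)] [cite: LangerMattis1971, eq. (4)] -/
theorem neelClass_energy_ge_halfFilling (h472 : cert_r472_pb2_tl_upper_n1_U8) (hL : 3 ≤ L) (hLe : Even L) {m : ℝ}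
    {φ : Fock (Orb (FermionTorus 2 L))} (hφ : φ ≠ 0)
    (hN : (star φ ⬝ᵥ (totalNumber *ᵥ φ)).re = 1 * (L : ℝ) ^ 2 * normSq φ)
    (hO : (star φ ⬝ᵥ ((dGammaSpin 0 (stagMatrix 2 L) - dGammaSpin 1 (stagMatrix 2 L)) *ᵥ φ)).re =
      2 * m * (L : ℝ) ^ 2 * normSq φ)
    (hD : ((1 : ℝ) ^ 2 / 4 - m ^ 2) * (L : ℝ) ^ 2 * normSq φ ≤
      (star φ ⬝ᵥ ((∑ x : FermionTorus 2 L, numberOp x 0 * numberOp x 1) *ᵥ φ)).re) :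
    energyDensityTT' 1 0 8 (1) + 1 / 256 ≤
      (star φ ⬝ᵥ (hubbardTorusTT' L 1 0 8 *ᵥ φ)).re / ((L : ℝ) ^ 2 * normSq φ) := by
  have hcap : energyDensityTT' 1 0 8 (1 : ℝ) ≤ -0.5087724429 := by
    rw [energyDensityTT'_zero]
    refine (m2_U8_upper_r472_print h472).trans ?_
    push_cast
    norm_num
  have hm : 2 * |m| ≤ 1 := two_abs_stag_le_density hφ hN hO
  have h0 : 0 ≤ |m| := abs_nonneg m
  have hsq : m ^ 2 = |m| ^ 2 := (sq_abs m).symm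
  have key : ∀ δ : ℝ, 0 < δ → 
      2 * δ * |m| + δ * (1 - 1) - Real.sqrt (4 * (1 : ℝ) ^ 2 + δ ^ 2) + 8 * ((1 : ℝ) ^ 2 / 4 - |m| ^ 2) ≤
        (star φ ⬝ᵥ (hubbardTorusTT' L 1 0 8 *ᵥ φ)).re / ((L : ℝ) ^ 2 * normSq φ) := by
    intro δ hδ
    have h := neelClass_energy_per_site_ge hL hLe 1 (t' := 0) (U := 8) le_rfl (by norm_num) hδ
      (by rw [abs_zero]; linarith) (by rw [abs_zero]; norm_num) hφ hN hO hD
    rw [hsq] at h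
    exact h
  rcases le_or_gt |m| (1 / 8) with c1 | c1
  · -- piece 1: |m| ∈ [0, 1/8], δ = 1/2, √(4+δ²) ≤ 2061553/1000000 (slack 0.4433)
    have h := key (1 / 2) (by norm_num)
    have hr : Real.sqrt (4 * (1 : ℝ) ^ 2 + (1 / 2 : ℝ) ^ 2) ≤ 2061553 / 1000000 :=
      (Real.sqrt_le_sqrt (by norm_num)).trans_eq (Real.sqrt_sq (by norm_num))
    linarith [mul_nonneg h0 (sub_nonneg.2 c1), h, hr, hcap]
  rcases le_or_gt |m| (1 / 4) with c2 | c2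
  · -- piece 2: |m| ∈ [1/8, 1/4], δ = 23/20, √(4+δ²) ≤ 461411/200000 (slack 0.2728)
    have h := key (23 / 20) (by norm_num)
    have hr : Real.sqrt (4 * (1 : ℝ) ^ 2 + (23 / 20 : ℝ) ^ 2) ≤ 461411 / 200000 :=
      (Real.sqrt_le_sqrt (by norm_num)).trans_eq (Real.sqrt_sq (by norm_num))
    linarith [mul_nonneg (sub_nonneg.2 c1.le) (sub_nonneg.2 c2), h, hr, hcap]
  rcases le_or_gt |m| (3 / 8) with c3 | c3
  · -- piece 3: |m| ∈ [1/4, 3/8], δ = 227/100, √(4+δ²) ≤ 3025377/1000000 (slack 0.0570)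
    have h := key (227 / 100) (by norm_num)
    have hr : Real.sqrt (4 * (1 : ℝ) ^ 2 + (227 / 100 : ℝ) ^ 2) ≤ 3025377 / 1000000 :=
      (Real.sqrt_le_sqrt (by norm_num)).trans_eq (Real.sqrt_sq (by norm_num))
    linarith [mul_nonneg (sub_nonneg.2 c2.le) (sub_nonneg.2 c3), h, hr, hcap]
  rcases le_or_gt |m| (13 / 32) with c4 | c4
  · -- piece 4: |m| ∈ [3/8, 13/32], δ = 279/100, √(4+δ²) ≤ 1716399/500000 (slack 0.0186)
    have h := key (279 / 100) (by norm_num)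
    have hr : Real.sqrt (4 * (1 : ℝ) ^ 2 + (279 / 100 : ℝ) ^ 2) ≤ 1716399 / 500000 :=
      (Real.sqrt_le_sqrt (by norm_num)).trans_eq (Real.sqrt_sq (by norm_num))
    linarith [mul_nonneg (sub_nonneg.2 c3.le) (sub_nonneg.2 c4), h, hr, hcap]
  rcases le_or_gt |m| (7 / 16) with c5 | c5
  · -- piece 5: |m| ∈ [13/32, 7/16], δ = 337/100, √(4+δ²) ≤ 3918789/1000000 (slack 0.0036)
    have h := key (337 / 100) (by norm_num)
    have hr : Real.sqrt (4 * (1 : ℝ) ^ 2 + (337 / 100 : ℝ) ^ 2) ≤ 3918789 / 1000000 :=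
      (Real.sqrt_le_sqrt (by norm_num)).trans_eq (Real.sqrt_sq (by norm_num))
    linarith [mul_nonneg (sub_nonneg.2 c4.le) (sub_nonneg.2 c5), h, hr, hcap]
  -- piece 6: |m| ∈ [7/16, 1/2], δ = 15/4, √(4+δ²) ≤ 4250001/1000000 (slack 0.0049)
  have h := key (15 / 4) (by norm_num)
  have hr : Real.sqrt (4 * (1 : ℝ) ^ 2 + (15 / 4 : ℝ) ^ 2) ≤ 4250001 / 1000000 :=
    (Real.sqrt_le_sqrt (by norm_num)).trans_eq (Real.sqrt_sq (by norm_num))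
  linarith [mul_nonneg (sub_nonneg.2 c5.le) (sub_nonneg.2 (show |m| ≤ 1 / 2 by linarith)), h, hr, hcap]

end Summit.Ventures.CertifiedManyBodySolver.Observables

end
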